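import Summits.CriticalPhenomena.CardyFormulaZ2.Theorems.CardyComplexConeParafermionToSLESixFamiliesDiamondDefsR5
import Summits.CriticalPhenomena.CardyFormulaZ2.Theorems.CardyComplexConeParafermionToSLESixFamiliesDiamondArcsFrame
import Summits.CriticalPhenomena.CardyFormulaZ2.Theorems.CardyComplexConeParafermionToSLESixFamiliesDiamondIdentifyMesh
import HarnessLib

/-!
# The collar of line `potential-darboux-picard-diamond`, part 1: leg sums, the deep box, the envelope at lattice depth

Crux `ParafermionToSLESixFamilies` (stmt-CriticalPhenomena-11389), line `potential-darboux-picard-diamond`, conditional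
helper `collar_of_uniformInnerEnvelope : UniformInnerEnvelope → ClosedCollar` of S3 (a) (the COLLAR: asymptotic
equicontinuity of `δ^{2/3}Ψ` over exact pairs on the cells of the closed marked diamond). The increment of an exact pair's
site potential `Φ` along a lattice path `u₀, …, u_n` of interior sites is a telescoping sum of corner observables through
the common faces, `‖Φ u₀ − Φ u_n‖ ≤ Σ_{k<n} (B u_k + B u_{k+1})` with `B u = C₁ · (depth u)^{-1/3}` under
`UniformInnerEnvelope`. This file carries the three scalar inputs of that estimate:

* `diamondCollar_legSum` (registered) — the real analysis of the two kinds of legs of the chain: `Σ_{k<N} (k+1)^{-1/3} ≤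
  (3/2) N^{2/3}` (Mathlib's `AntitoneOn.sum_le_integral_Ico`, `integral_rpow`), so an INWARD leg whose `k`-th site has
  depth `≥ k + 1` costs `≤ 3 C n^{2/3}` and an ACROSS leg of `n ≤ M + 1` steps at depth `≥ M + 1` costs `≤ 2 C (M+1)^{2/3}`;
* `diamondCollar_box` (registered) — the lattice points of a small-mesh diamond form a box `a ≤ x₀ + x₁ ≤ b`,
  `a' ≤ x₁ − x₀ ≤ b'` (as in the landed `diamondArcs_exists_box`) whose side lengths are `≥ 2√2 α/δ − 2`, `≥ 2√2 β/δ − 2`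
  and, NEW, whose points lie at Euclidean distance `≥ (δ/2) · μ` from the complement for every integer `μ` below the
  LATTICE DEPTH `min(x₀ + x₁ − a, b − x₀ − x₁, x₁ − x₀ − a', b' − x₁ + x₀)` (the two-layer frame is depth `≤ 1`);
* `obsBound_of_uniformInnerEnvelope` — the envelope in depth form: `‖cornerObs E E.δ u g‖ ≤ C₁ m^{-1/3}` whenever
  `(E.δ/2) m ≤ dist(δu, Dᶜ)`, `m ≥ 2` (`R = ⌊m/2⌋ ≥ m/4` in `UniformInnerEnvelope`; `C₁ = max(C,0) · 4^{1/3}`).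

Elementary; nothing cited.
-/

noncomputable section

namespace Summit.CriticalPhenomena.CardyFormulaZ2.Cruxes.ParafermionToSLESixFamilies.PotentialDarbouxPicardDiamond

open scoped BigOperators
open MeasureTheory Set Metric Complex
open Literature.Probability Literature.Probability.LatticeModels Literature.Probability.Percolation
open Literature.Probability.LatticeModels.DiscreteDobrushin
open Literature.Probability.RandomPlanarGeometry
open Summit.CriticalPhenomena.CardyFormulaZ2.Cruxes.EdgePrecompact.QkzStripBoundaryArm (cornerObs UniformInnerEnvelope)

namespace Collar

/-! ## The power sum -/

/-- `u ↦ u^{-1/3}` is antitone on `[1, ∞)`-intervals. -/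
theorem antitoneOn_rpow_neg_third (N : ℕ) :
    AntitoneOn (fun u : ℝ => u ^ (-(1:ℝ) / 3)) (Icc ((1 : ℕ) : ℝ) N) := by
  intro u hu v _ huv
  have hu1 : (0 : ℝ) < u := by have := hu.1; push_cast at this; linarith
  exact Real.rpow_le_rpow_of_nonpos hu1 huv (by norm_num)

/-- **`Σ_{k<N} (k+1)^{-1/3} ≤ (3/2) N^{2/3}`** (comparison with `∫_1^N u^{-1/3} du = (3/2)(N^{2/3} − 1)`). -/
theorem sum_range_succ_rpow_neg_third_le (N : ℕ) :
    ∑ k ∈ Finset.range N, ((k : ℝ) + 1) ^ (-(1:ℝ) / 3) ≤ 3 / 2 * (N : ℝ) ^ ((2:ℝ) / 3) := by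
  rcases Nat.eq_zero_or_pos N with rfl | hN
  · simp
  have hN1 : 1 ≤ N := hN
  rw [Finset.range_eq_Ico, ← Finset.sum_Ico_consecutive _ (Nat.zero_le 1) hN1, Finset.sum_Ico_succ_top (Nat.zero_le 0),
    Finset.Ico_self, Finset.sum_empty]
  simp only [CharP.cast_eq_zero, zero_add, Real.one_rpow]
  have h1 := AntitoneOn.sum_le_integral_Ico hN1 (antitoneOn_rpow_neg_third N)
  have h2 : ∫ u in ((1 : ℕ) : ℝ)..N, u ^ (-(1:ℝ) / 3) = ((N : ℝ) ^ ((2:ℝ) / 3) - 1) / ((2:ℝ) / 3) := by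
    rw [integral_rpow (Or.inl (by norm_num))]
    push_cast
    rw [Real.one_rpow]
    norm_num
  have h3 : ∑ k ∈ Finset.Ico 1 N, ((k : ℝ) + 1) ^ (-(1:ℝ) / 3) = ∑ k ∈ Finset.Ico 1 N, (((k + 1 : ℕ) : ℝ)) ^ (-(1:ℝ) / 3) := by
    push_cast; rfl
  rw [h3]
  have h4 : (1 : ℝ) ≤ (N : ℝ) ^ ((2:ℝ) / 3) := Real.one_le_rpow (by exact_mod_cast hN1) (by norm_num)
  linarith [h1, h2]

/-! ## Telescoping along a path -/

/-- **Telescoping estimate along a path**: if consecutive values differ by at most `β k + β (k+1)`, then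
`‖a 0 − a n‖ ≤ Σ_{k<n} (β k + β (k+1))`. -/
theorem norm_sub_le_sum_of_path (a : ℕ → ℂ) (β : ℕ → ℝ) (n : ℕ)
    (h : ∀ k < n, ‖a k - a (k + 1)‖ ≤ β k + β (k + 1)) :
    ‖a 0 - a n‖ ≤ ∑ k ∈ Finset.range n, (β k + β (k + 1)) := by
  induction n with
  | zero => simp
  | succ n ih =>
    calc ‖a 0 - a (n + 1)‖ ≤ ‖a 0 - a n‖ + ‖a n - a (n + 1)‖ := norm_sub_le_norm_sub_add_norm_sub _ _ _
      _ ≤ (∑ k ∈ Finset.range n, (β k + β (k + 1))) + (β n + β (n + 1)) :=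
          add_le_add (ih fun k hk => h k (by omega)) (h n (by omega))
      _ = ∑ k ∈ Finset.range (n + 1), (β k + β (k + 1)) := by rw [Finset.sum_range_succ]

/-! ## The two leg sums -/

/-- **Inward leg**: if `β k ≤ C (k+1)^{-1/3}` for `k ≤ n` (`C ≥ 0`), then `Σ_{k<n} (β k + β (k+1)) ≤ 3 C n^{2/3}`. -/
theorem legSum_inward {β : ℕ → ℝ} {C : ℝ} (hC : 0 ≤ C) (n : ℕ)
    (h : ∀ k ≤ n, β k ≤ C * ((k : ℝ) + 1) ^ (-(1:ℝ) / 3)) :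
    ∑ k ∈ Finset.range n, (β k + β (k + 1)) ≤ 3 * C * (n : ℝ) ^ ((2:ℝ) / 3) := by
  have step : ∀ k < n, β k + β (k + 1) ≤ 2 * C * ((k : ℝ) + 1) ^ (-(1:ℝ) / 3) := by
    intro k hk
    have hk1 := h k hk.le
    have hk2 := h (k + 1) (by omega)
    have hmono : (((k + 1 : ℕ) : ℝ) + 1) ^ (-(1:ℝ) / 3) ≤ ((k : ℝ) + 1) ^ (-(1:ℝ) / 3) := by
      push_cast
      exact Real.rpow_le_rpow_of_nonpos (by positivity) (by linarith) (by norm_num)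
    have := mul_le_mul_of_nonneg_left hmono hC
    linarith
  calc ∑ k ∈ Finset.range n, (β k + β (k + 1)) ≤ ∑ k ∈ Finset.range n, 2 * C * ((k : ℝ) + 1) ^ (-(1:ℝ) / 3) :=
        Finset.sum_le_sum fun k hk => step k (Finset.mem_range.1 hk)
    _ = 2 * C * ∑ k ∈ Finset.range n, ((k : ℝ) + 1) ^ (-(1:ℝ) / 3) := by rw [Finset.mul_sum]
    _ ≤ 2 * C * (3 / 2 * (n : ℝ) ^ ((2:ℝ) / 3)) :=
        mul_le_mul_of_nonneg_left (sum_range_succ_rpow_neg_third_le n) (by positivity)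
    _ = 3 * C * (n : ℝ) ^ ((2:ℝ) / 3) := by ring

/-- **Across leg**: if `β k ≤ C (M+1)^{-1/3}` for `k ≤ m` and `m ≤ M + 1` (`C ≥ 0`), then
`Σ_{k<m} (β k + β (k+1)) ≤ 2 C (M+1)^{2/3}`. -/
theorem legSum_across {β : ℕ → ℝ} {C : ℝ} (hC : 0 ≤ C) {m M : ℕ} (hm : m ≤ M + 1)
    (h : ∀ k ≤ m, β k ≤ C * ((M : ℝ) + 1) ^ (-(1:ℝ) / 3)) :
    ∑ k ∈ Finset.range m, (β k + β (k + 1)) ≤ 2 * C * ((M : ℝ) + 1) ^ ((2:ℝ) / 3) := by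
  have hM : (0 : ℝ) < (M : ℝ) + 1 := by positivity
  have step : ∀ k < m, β k + β (k + 1) ≤ 2 * C * ((M : ℝ) + 1) ^ (-(1:ℝ) / 3) := by
    intro k hk
    have hk1 := h k hk.le
    have hk2 := h (k + 1) (by omega)
    linarith
  have hpow : ((M : ℝ) + 1) * ((M : ℝ) + 1) ^ (-(1:ℝ) / 3) = ((M : ℝ) + 1) ^ ((2:ℝ) / 3) := by
    rw [show (2:ℝ) / 3 = -(1:ℝ) / 3 + 1 by norm_num, Real.rpow_add_one hM.ne', mul_comm]
  calc ∑ k ∈ Finset.range m, (β k + β (k + 1)) ≤ ∑ _k ∈ Finset.range m, 2 * C * ((M : ℝ) + 1) ^ (-(1:ℝ) / 3) :=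
        Finset.sum_le_sum fun k hk => step k (Finset.mem_range.1 hk)
    _ = m * (2 * C * ((M : ℝ) + 1) ^ (-(1:ℝ) / 3)) := by rw [Finset.sum_const, Finset.card_range, nsmul_eq_mul]
    _ ≤ ((M : ℝ) + 1) * (2 * C * ((M : ℝ) + 1) ^ (-(1:ℝ) / 3)) := by
        apply mul_le_mul_of_nonneg_right
        · exact_mod_cast hm
        · have := Real.rpow_nonneg hM.le (-(1:ℝ) / 3); positivity
    _ = 2 * C * ((M : ℝ) + 1) ^ ((2:ℝ) / 3) := by rw [← hpow]; ring

end Collar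

/-- **The two leg sums of the collar chain** (registered helper of `collar_of_uniformInnerEnvelope`). Along a path
`a 0, …, a n` of complex values whose consecutive differences are bounded by `β k + β (k+1)`:
(INWARD) if `β k ≤ C (k+1)^{-1/3}` for `k ≤ n` then `‖a 0 − a n‖ ≤ 3 C n^{2/3}`; (ACROSS) if `β k ≤ C (M+1)^{-1/3}` for
`k ≤ n` and `n ≤ M + 1` then `‖a 0 − a n‖ ≤ 2 C (M+1)^{2/3}`. -/
theorem diamondCollar_legSum : ∀ (a : ℕ → ℂ) (β : ℕ → ℝ) (C : ℝ) (n : ℕ), 0 ≤ C → (∀ k < n, ‖a k - a (k + 1)‖ ≤ β k + β (k + 1)) → ((∀ k ≤ n, β k ≤ C * ((k : ℝ) + 1) ^ (-(1:ℝ) / 3)) → ‖a 0 - a n‖ ≤ 3 * C * (n : ℝ) ^ ((2:ℝ) / 3)) ∧ (∀ M : ℕ, n ≤ M + 1 → (∀ k ≤ n, β k ≤ C * ((M : ℝ) + 1) ^ (-(1:ℝ) / 3)) → ‖a 0 - a n‖ ≤ 2 * C * ((M : ℝ) + 1) ^ ((2:ℝ) / 3)) := by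
  intro a β C n hC hpath
  exact ⟨fun h => (Collar.norm_sub_le_sum_of_path a β n hpath).trans (Collar.legSum_inward hC n h),
    fun M hM h => (Collar.norm_sub_le_sum_of_path a β n hpath).trans (Collar.legSum_across hC hM h)⟩

/-! ## The lattice depth in a box -/

namespace Collar

/-! ## One tilted coordinate: depth from the interval description -/

/-- In one tilted coordinate: if the integers `s` with `|h s + X₀| < α` are exactly `[a, b]`, then for such `s`
the distance to the nearer end controls the slack: `|h s + X₀| + h · min(s − a, b − s) < α`. -/
theorem abs_add_mul_min_lt {h X₀ α : ℝ} {a b : ℤ} (hab : ∀ s : ℤ, |h * s + X₀| < α ↔ a ≤ s ∧ s ≤ b)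
    {s : ℤ} (hs : a ≤ s ∧ s ≤ b) : |h * s + X₀| + h * ((min (s - a) (b - s) : ℤ) : ℝ) < α := by
  set m : ℤ := min (s - a) (b - s) with hm
  have hm1 : m ≤ s - a := min_le_left _ _
  have hm2 : m ≤ b - s := min_le_right _ _
  have k1 := (hab (s - m)).2 ⟨by omega, by omega⟩
  have k2 := (hab (s + m)).2 ⟨by omega, by omega⟩
  push_cast at k1 k2
  rw [abs_lt] at k1 k2
  have e1 : h * ((s : ℝ) - m) = h * s - h * m := by ring
  have e2 : h * ((s : ℝ) + m) = h * s + h * m := by ring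
  rcases le_or_gt 0 (h * s + X₀) with h0 | h0
  · rw [abs_of_nonneg h0]; linarith [k2.2]
  · rw [abs_of_neg h0]; linarith [k1.1]

/-! ## The box of a diamond with its depth -/

/-- The tilted frame vector `e = exp(−iπ/4)` is a unit: `α e⁻¹ e = α`, so `c + α e⁻¹` is NOT in the open diamond. -/
theorem compl_tiltedBox_nonempty (c : ℂ) {α : ℝ} (hα : 0 < α) (β : ℝ) :
    ({z : ℂ | |((z - c) * exp (-(Real.pi / 4 : ℝ) * I)).re| < α ∧ |((z - c) * exp (-(Real.pi / 4 : ℝ) * I)).im| < β}ᶜ).Nonempty := by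
  refine ⟨c + (α : ℂ) * (exp (-(Real.pi / 4 : ℝ) * I))⁻¹, ?_⟩
  rw [mem_compl_iff, mem_setOf_eq, not_and_or]
  left
  rw [add_sub_cancel_left, mul_assoc, inv_mul_cancel₀ (exp_ne_zero _), mul_one, ofReal_re, abs_of_pos hα]
  exact lt_irrefl _

/-- **Depth of a box point.** In the open diamond `S = {|re((z − c)e)| < α, |im((z − c)e)| < β}` whose lattice points at
mesh `δ` are the box `[a, b] × [a', b']` (coordinates `s = x₀ + x₁`, `d = x₁ − x₀`, tilted abscissa `(δ/√2) s + X₀`,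
ordinate `(δ/√2) d + Y₀`), a box point `x` is at distance `≥ (δ/√2) μ ≥ (δ/2) μ` from `Sᶜ` for every integer `μ` below
its lattice depth `min(s − a, b − s, d − a', b' − d)`. -/
theorem depth_le_infDist (c : ℂ) {α β δ : ℝ} (hδ : 0 < δ) (hα : 0 < α) {a b a' b' : ℤ}
    (hab : ∀ s : ℤ, |Real.sqrt 2 / 2 * δ * s + -(Real.sqrt 2 / 2 * (c.re + c.im))| < α ↔ a ≤ s ∧ s ≤ b)
    (hab' : ∀ s : ℤ, |Real.sqrt 2 / 2 * δ * s + -(Real.sqrt 2 / 2 * (c.im - c.re))| < β ↔ a' ≤ s ∧ s ≤ b')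
    {x : Site 2} (hx : a ≤ x 0 + x 1 ∧ x 0 + x 1 ≤ b ∧ a' ≤ x 1 - x 0 ∧ x 1 - x 0 ≤ b') {μ : ℤ}
    (hμ : μ ≤ x 0 + x 1 - a ∧ μ ≤ b - (x 0 + x 1) ∧ μ ≤ x 1 - x 0 - a' ∧ μ ≤ b' - (x 1 - x 0)) :
    δ / 2 * (μ : ℝ) ≤ infDist (meshPoint δ x)
      {z : ℂ | |((z - c) * exp (-(Real.pi / 4 : ℝ) * I)).re| < α ∧ |((z - c) * exp (-(Real.pi / 4 : ℝ) * I)).im| < β}ᶜ := by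
  -- a negative depth bound is trivial
  rcases lt_or_ge μ 0 with hneg | hμ0
  · have : δ / 2 * (μ : ℝ) ≤ 0 := by
      have : (μ : ℝ) < 0 := by exact_mod_cast hneg
      nlinarith
    exact this.trans infDist_nonneg
  set e : ℂ := exp (-(Real.pi / 4 : ℝ) * I) with he_def
  have he : ‖e‖ = 1 := norm_exp_neg_pi_div_four_mul_I
  set h : ℝ := Real.sqrt 2 / 2 * δ with hh_def
  have hh : 0 < h := by positivity
  have hs2 : (1 : ℝ) ≤ Real.sqrt 2 := by
    rw [show (1:ℝ) = Real.sqrt 1 by simp]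
    exact Real.sqrt_le_sqrt (by norm_num)
  have hhδ : δ / 2 ≤ h := by rw [hh_def]; nlinarith
  -- tilted coordinates of `δx`
  obtain ⟨eX, eY⟩ := tilt_meshPoint δ c x
  set X := ((meshPoint δ x - c) * e).re with hX
  set Y := ((meshPoint δ x - c) * e).im with hY
  have hXe : X = h * ((x 0 + x 1 : ℤ) : ℝ) + -(Real.sqrt 2 / 2 * (c.re + c.im)) := by rw [eX, hh_def]; push_cast; ring
  have hYe : Y = h * ((x 1 - x 0 : ℤ) : ℝ) + -(Real.sqrt 2 / 2 * (c.im - c.re)) := by rw [eY, hh_def]; push_cast; ring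
  -- one-dimensional slacks
  have kX := abs_add_mul_min_lt hab ⟨hx.1, hx.2.1⟩
  have kY := abs_add_mul_min_lt hab' ⟨hx.2.2.1, hx.2.2.2⟩
  rw [← hXe] at kX
  rw [← hYe] at kY
  -- `μ` is below both one-dimensional margins
  have hmX : (μ : ℝ) ≤ ((min (x 0 + x 1 - a) (b - (x 0 + x 1)) : ℤ) : ℝ) := by
    exact_mod_cast le_min hμ.1 hμ.2.1
  have hmY : (μ : ℝ) ≤ ((min (x 1 - x 0 - a') (b' - (x 1 - x 0)) : ℤ) : ℝ) := by
    exact_mod_cast le_min hμ.2.2.1 hμ.2.2.2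
  -- every point within `h · margin` of `δx` is in the diamond
  refine (le_infDist (compl_tiltedBox_nonempty c hα β)).2 fun z hz => ?_
  by_contra hlt
  push Not at hlt
  apply hz
  have hdist : ‖z - meshPoint δ x‖ < h * (μ : ℝ) := by
    rw [← dist_eq_norm, dist_comm]
    calc dist (meshPoint δ x) z < δ / 2 * (μ : ℝ) := hlt
      _ ≤ h * (μ : ℝ) := by
          have hm0 : (0 : ℝ) ≤ (μ : ℝ) := by exact_mod_cast hμ0
          exact mul_le_mul_of_nonneg_right hhδ hm0
  have hre : |((z - c) * e).re - X| ≤ ‖z - meshPoint δ x‖ := by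
    have : ((z - c) * e).re - X = ((z - meshPoint δ x) * e).re := by
      rw [hX, ← sub_re, ← sub_mul]; congr 1; ring
    rw [this]
    refine (abs_re_le_norm _).trans ?_
    rw [norm_mul, he, mul_one]
  have him : |((z - c) * e).im - Y| ≤ ‖z - meshPoint δ x‖ := by
    have : ((z - c) * e).im - Y = ((z - meshPoint δ x) * e).im := by
      rw [hY, ← sub_im, ← sub_mul]; congr 1; ring
    rw [this]
    refine (abs_im_le_norm _).trans ?_
    rw [norm_mul, he, mul_one]
  have hm1 := mul_le_mul_of_nonneg_left hmX hh.le
  have hm2 := mul_le_mul_of_nonneg_left hmY hh.le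
  constructor
  · have := abs_sub_abs_le_abs_sub ((z - c) * e).re X
    linarith
  · have := abs_sub_abs_le_abs_sub ((z - c) * e).im Y
    linarith

end Collar

open Collar

/-- **The lattice points of a small-mesh diamond form a DEEP box** (registered helper of `collar_of_uniformInnerEnvelope`):
for `0 < δ < min(α, β)/4` the mesh points `δx` of the open diamond `{|re((z − c)e^{−iπ/4})| < α, |im(·)| < β}` are exactly
the box `a ≤ x₀ + x₁ ≤ b`, `a' ≤ x₁ − x₀ ≤ b'`, with `b − a, b' − a' ≥ 6`, side lengths `δ(b − a) + 2δ ≥ 2√2 α`,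
`δ(b' − a') + 2δ ≥ 2√2 β`, and every box point at Euclidean distance `≥ (δ/2) μ` from the complement for every integer `μ`
below its lattice depth `min(x₀ + x₁ − a, b − (x₀ + x₁), x₁ − x₀ − a', b' − (x₁ − x₀))`. -/
theorem diamondCollar_box : ∀ (c : ℂ) (α β δ : ℝ), 0 < δ → δ < α / 4 → δ < β / 4 → ∃ a b a' b' : ℤ, 6 ≤ b - a ∧ 6 ≤ b' - a' ∧ 2 * Real.sqrt 2 * α ≤ δ * (b - a) + 2 * δ ∧ 2 * Real.sqrt 2 * β ≤ δ * (b' - a') + 2 * δ ∧ (∀ x : Site 2, (|((meshPoint δ x - c) * exp (-(Real.pi / 4 : ℝ) * I)).re| < α ∧ |((meshPoint δ x - c) * exp (-(Real.pi / 4 : ℝ) * I)).im| < β) ↔ (a ≤ x 0 + x 1 ∧ x 0 + x 1 ≤ b ∧ a' ≤ x 1 - x 0 ∧ x 1 - x 0 ≤ b')) ∧ ∀ x : Site 2, (a ≤ x 0 + x 1 ∧ x 0 + x 1 ≤ b ∧ a' ≤ x 1 - x 0 ∧ x 1 - x 0 ≤ b') → ∀ μ : ℤ, (μ ≤ x 0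 + x 1 - a ∧ μ ≤ b - (x 0 + x 1) ∧ μ ≤ x 1 - x 0 - a' ∧ μ ≤ b' - (x 1 - x 0)) → δ / 2 * (μ : ℝ) ≤ infDist (meshPoint δ x) {z : ℂ | |((z - c) * exp (-(Real.pi / 4 : ℝ) * I)).re| < α ∧ |((z - c) * exp (-(Real.pi / 4 : ℝ) * I)).im| < β}ᶜ := by
  intro c α β δ hδ hδα hδβ
  have hα : 0 < α := by linarith
  have hh : 0 < Real.sqrt 2 / 2 * δ := by positivity
  have hs2lt : Real.sqrt 2 / 2 < 1 := by
    rw [div_lt_one two_pos, Real.sqrt_lt' two_pos]; norm_num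
  have hhδ : Real.sqrt 2 / 2 * δ < δ := by nlinarith
  obtain ⟨a, b, hab, hw⟩ := ArcsConn.exists_int_interval (X₀ := -(Real.sqrt 2 / 2 * (c.re + c.im))) (α := α) hh
  obtain ⟨a', b', hab', hw'⟩ := ArcsConn.exists_int_interval (X₀ := -(Real.sqrt 2 / 2 * (c.im - c.re))) (α := β) hh
  have hs2 : Real.sqrt 2 * Real.sqrt 2 = 2 := Real.mul_self_sqrt (by norm_num)
  refine ⟨a, b, a', b', ArcsConn.six_le_of_width hh (by linarith) hw, ArcsConn.six_le_of_width hh (by linarith) hw', ?_, ?_,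
    fun x => ?_, fun x hx μ hμ => depth_le_infDist c hδ hα hab hab' hx hμ⟩
  · have := mul_le_mul_of_nonneg_left hw (Real.sqrt_nonneg 2)
    have e : Real.sqrt 2 * (Real.sqrt 2 / 2 * δ * (b - a) + 2 * (Real.sqrt 2 / 2 * δ)) = δ * (b - a) + 2 * δ := by
      have : Real.sqrt 2 * (Real.sqrt 2 / 2) = 1 := by rw [← mul_div_assoc, hs2]; norm_num
      calc _ = Real.sqrt 2 * (Real.sqrt 2 / 2) * (δ * (b - a) + 2 * δ) := by ring
        _ = _ := by rw [this, one_mul]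
    linarith
  · have := mul_le_mul_of_nonneg_left hw' (Real.sqrt_nonneg 2)
    have e : Real.sqrt 2 * (Real.sqrt 2 / 2 * δ * (b' - a') + 2 * (Real.sqrt 2 / 2 * δ)) = δ * (b' - a') + 2 * δ := by
      have : Real.sqrt 2 * (Real.sqrt 2 / 2) = 1 := by rw [← mul_div_assoc, hs2]; norm_num
      calc _ = Real.sqrt 2 * (Real.sqrt 2 / 2) * (δ * (b' - a') + 2 * δ) := by ring
        _ = _ := by rw [this, one_mul]
    linarith
  · obtain ⟨e1, e2⟩ := tilt_meshPoint δ c x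
    have k1 := hab (x 0 + x 1)
    have k2 := hab' (x 1 - x 0)
    push_cast at k1 k2
    rw [e1, e2, show Real.sqrt 2 / 2 * δ * ((x 0 : ℝ) + x 1) - Real.sqrt 2 / 2 * (c.re + c.im) =
      Real.sqrt 2 / 2 * δ * ((x 0 : ℝ) + x 1) + -(Real.sqrt 2 / 2 * (c.re + c.im)) by ring,
      show Real.sqrt 2 / 2 * δ * ((x 1 : ℝ) - x 0) - Real.sqrt 2 / 2 * (c.im - c.re) =
      Real.sqrt 2 / 2 * δ * ((x 1 : ℝ) - x 0) + -(Real.sqrt 2 / 2 * (c.im - c.re)) by ring, k1, k2]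
    tauto

/-! ## The corner observable bound at lattice depth, from `UniformInnerEnvelope` -/

/-- **From `UniformInnerEnvelope` to the depth form used along cell chains**: one constant `C₁ ≥ 0` such that for
every Dobrushin domain `D`, every admissible datum `E` on it with positive mesh, every integer `m ≥ 2` and every corner
`(u, g)` with `(E.δ/2) · m ≤ dist(δu, Dᶜ)`: `‖cornerObs E E.δ u g‖ ≤ C₁ · m^{−1/3}` (take `R = ⌊m/2⌋ ≥ m/4`). -/
theorem obsBound_of_uniformInnerEnvelope : UniformInnerEnvelope → ∃ C₁ : ℝ, 0 ≤ C₁ ∧ ∀ (D : DobrushinDomain) (E : DiscreteDobrushin), E.Ω = D.carrier → E.IsZdAdmissible → 0 < E.δ → ∀ (m : ℤ) (u g : Site 2), IsCorner u g → 2 ≤ m → E.δ / 2 * (m : ℝ) ≤ infDist (meshPoint E.δ u) D.carrierᶜ → ‖cornerObs E E.δ u g‖ ≤ C₁ * (m : ℝ) ^ (-(1:ℝ) / 3) := by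
  rintro ⟨C, hC⟩
  have h4 : (0 : ℝ) < (4 : ℝ) ^ (-(1:ℝ) / 3) := Real.rpow_pos_of_pos (by norm_num) _
  refine ⟨max C 0 / (4 : ℝ) ^ (-(1:ℝ) / 3), by positivity, ?_⟩
  intro D E hΩ hE hδ m u g hug hm hdepth
  -- the natural depth `R = ⌊m/2⌋`
  obtain ⟨R, hR⟩ : ∃ R : ℕ, (R : ℤ) = m / 2 := ⟨(m / 2).toNat, Int.toNat_of_nonneg (by omega)⟩
  have hR1 : 1 ≤ R := by have : (1 : ℤ) ≤ R := by rw [hR]; omega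
                         exact_mod_cast this
  have hR2 : 2 * (R : ℤ) ≤ m := by rw [hR]; omega
  have hR4 : m ≤ 4 * (R : ℤ) := by rw [hR]; omega
  have hR2' : (R : ℝ) ≤ (m : ℝ) / 2 := by
    have : ((2 * (R : ℤ) : ℤ) : ℝ) ≤ (m : ℝ) := by exact_mod_cast hR2
    push_cast at this; linarith
  have hR4' : (m : ℝ) / 4 ≤ (R : ℝ) := by
    have : (m : ℝ) ≤ ((4 * (R : ℤ) : ℤ) : ℝ) := by exact_mod_cast hR4
    push_cast at this; linarith
  have hm0 : (0 : ℝ) < (m : ℝ) := by exact_mod_cast (show (0:ℤ) < m by omega)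
  have hRδ : (R : ℝ) * E.δ ≤ infDist (meshPoint E.δ u) D.carrierᶜ :=
    le_trans (by nlinarith) hdepth
  have key := hC D E hΩ hE u g hug R hR1 hRδ
  -- `C R^{-1/3} ≤ (max C 0) (m/4)^{-1/3} = C₁ m^{-1/3}`
  have hRpow : (R : ℝ) ^ (-(1:ℝ) / 3) ≤ ((m : ℝ) / 4) ^ (-(1:ℝ) / 3) :=
    Real.rpow_le_rpow_of_nonpos (by positivity) hR4' (by norm_num)
  have hdiv : ((m : ℝ) / 4) ^ (-(1:ℝ) / 3) = (m : ℝ) ^ (-(1:ℝ) / 3) / (4 : ℝ) ^ (-(1:ℝ) / 3) :=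
    Real.div_rpow hm0.le (by norm_num) _
  calc ‖cornerObs E E.δ u g‖ ≤ C * (R : ℝ) ^ (-(1:ℝ) / 3) := key
    _ ≤ max C 0 * (R : ℝ) ^ (-(1:ℝ) / 3) :=
        mul_le_mul_of_nonneg_right (le_max_left _ _) (Real.rpow_nonneg (Nat.cast_nonneg R) _)
    _ ≤ max C 0 * ((m : ℝ) / 4) ^ (-(1:ℝ) / 3) := mul_le_mul_of_nonneg_left hRpow (le_max_right _ _)
    _ = max C 0 / (4 : ℝ) ^ (-(1:ℝ) / 3) * (m : ℝ) ^ (-(1:ℝ) / 3) := by rw [hdiv]; field_simp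

end Summit.CriticalPhenomena.CardyFormulaZ2.Cruxes.ParafermionToSLESixFamilies.PotentialDarbouxPicardDiamond

end
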